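import Summits.HubbardSuperconductivity.HubbardLadder.NeelPolyCert2
import HarnessLib

/-!
# Σ-kernels: dictionary-infrared rows whose `L`-uniform constant is EXACT BY CONSTRUCTION (HubbardLadder R2, H₀ line; lineage-B validity lemma (i))

HONEST FRAMING: ladder R1–R4 with certified numbers; no claim on H/H₀.  Trigonometric-polynomial bookkeeping only; [folklore].  Reference
model: the spin-½ Heisenberg antiferromagnet on the even torus `(ℤ/2kℤ)²` through the tree's dictionary Kennedy–Lieb–Shastry rows
(`kls_heis_windowDict_cut_spinHalf`, whose only kernel-specific hypothesis is an `L`-uniform bound `𝓦_K(2k) ≤ W̄` on `klsKernelRiemannSum`).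
A **Σ-kernel** is a window-dictionary kernel `K(q) = t₀ - (2 + cos q₀ + cos q₁) R(q)²` with `t₀ ≥ 0`, `R = Σ g_{ab} v_{ab}` a cosine polynomial of
degree `≤ d`.  For every `θ > 0` and every torus of side `2k > 2d+1`: `𝓦_K(2k) ≤ W̄_θ :=` the constant coefficient of
`T_θ = R²(θ(2 - cos q₀ - cos q₁) + (2 + cos q₀ + cos q₁)/θ)/2`, because (1) `{-K}₊ ≤ (2 + cos q₀ + cos q₁)R²` (`t₀ ≥ 0`); (2) off the Néel point
`(2+s)((2-s)/(2+s))^{1/2} ≤ (θ(2-s) + (2+s)/θ)/2` (AM–GM), so the summand is `≤ T_θ ≥ 0`; (3) the lattice average of `T_θ` is its constant coefficient,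
all frequencies being `≤ 2d+1 < 2k` (character orthogonality, Literature `sum_cos_torusPhase`).  Steps (1)–(3) are proved here ONCE
(`sigma_riemannSum_le`, `sigma_cut_spinHalf(')`) directly on the Literature definition `klsKernelRiemannSum` (imports: `NeelPolyCert2` only); the
two kernel-specific identities (`W + t ≡ t₀ - E_Q·R²`, `Nu ≡ T_θ`) are decided by the kernel on rational arrays (`NeelPolyCert2.equiv2`); a certificate's
IRK rows are accumulated table-wise (`irk_acc_start/step/read`).  Pen: lineage B (pub-hubbard r2-eng-2 g5); design note
`pub-hubbard-r2-eng-2/design/SIGMA-VALIDITY-LEMMA.md`. [cite: KLS1988JSP, eqs. (4), (6)-(9)] [cite: DLS1978, Theorem 4.2] [folklore]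
-/


namespace Summit.HubbardSuperconductivity.HubbardLadder.PolyCert

open Finset Literature.MathematicalPhysics.QuantumLattice Literature.Probability.LatticeModels
open Summit.HubbardSuperconductivity.HubbardLadder

/-! ### Lattice sums of table series (character orthogonality) -/

/-- **Character orthogonality for products of cosines**: `Σ_q cos(m q₀) cos(m' q₁) = 0` on the dual torus of side `L` for
`(m,m') ≠ (0,0)`, `m, m' < L` (product-to-sum through the torus characters; Literature `sum_cos_torusPhase`). [folklore] -/
theorem sum_torus_cos_mul_cos_eq_zero (L : ℕ) [NeZero L] (m m' : ℕ) (hm : m < L) (hm' : m' < L)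
    (h : ¬(m = 0 ∧ m' = 0)) :
    ∑ q : TorusSite 2 L, Real.cos ((m : ℝ) * latticeMomentum L q 0) * Real.cos ((m' : ℝ) * latticeMomentum L q 1) = 0 := by
  have hm0 : ((m : ℕ) : ZMod L) = 0 → m = 0 := fun e =>
    Nat.eq_zero_of_dvd_of_lt ((ZMod.natCast_eq_zero_iff m L).1 e) hm
  have hm0' : ((m' : ℕ) : ZMod L) = 0 → m' = 0 := fun e =>
    Nat.eq_zero_of_dvd_of_lt ((ZMod.natCast_eq_zero_iff m' L).1 e) hm'
  have h01 : (0 : Fin 2) ≠ 1 := by decide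
  have hne1 : (Pi.single (0 : Fin 2) ((m : ℕ) : ZMod L) + Pi.single 1 ((m' : ℕ) : ZMod L) :
      TorusSite 2 L) ≠ 0 := by
    intro hw
    have e0 := congr_fun hw 0
    have e1 := congr_fun hw 1
    simp only [Pi.add_apply, Pi.single_eq_same, Pi.single_eq_of_ne h01, Pi.single_eq_of_ne h01.symm,
      add_zero, zero_add, Pi.zero_apply] at e0 e1
    exact h ⟨hm0 e0, hm0' e1⟩
  have hne2 : (Pi.single (0 : Fin 2) ((m : ℕ) : ZMod L) - Pi.single 1 ((m' : ℕ) : ZMod L) :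
      TorusSite 2 L) ≠ 0 := by
    intro hw
    have e0 := congr_fun hw 0
    have e1 := congr_fun hw 1
    simp only [Pi.sub_apply, Pi.single_eq_same, Pi.single_eq_of_ne h01, Pi.single_eq_of_ne h01.symm,
      sub_zero, zero_sub, neg_eq_zero, Pi.zero_apply] at e0 e1
    exact h ⟨hm0 e0, hm0' e1⟩
  simp_rw [cos_natCast_mul_latticeMomentum, cos_torusPhase_mul_cos_torusPhase]
  rw [← sum_div, sum_add_distrib, sum_cos_torusPhase, sum_cos_torusPhase, if_neg hne1, if_neg hne2]
  norm_num

/-- `|(ℤ/Lℤ)²| = L²` (real form). [folklore] -/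
private theorem card_torusSite_two_real' (L : ℕ) [NeZero L] :
    (Fintype.card (TorusSite 2 L) : ℝ) = (L : ℝ) ^ 2 := by
  rw [Fintype.card_pi, prod_const, ZMod.card, card_univ, Fintype.card_fin]
  push_cast
  ring

/-- Auxiliary lemma `sum_torus_rowSum_eq_zero`: a row with a non-zero frequency averages to zero. -/
theorem sum_torus_rowSum_eq_zero (L : ℕ) [NeZero L] (row : List ℚ) (m1 : ℕ) (hm1 : m1 < L) :
    ∀ j0 : ℕ, row.length + j0 ≤ L → ¬(m1 = 0 ∧ j0 = 0) →
      ∑ q : TorusSite 2 L, rowSum row j0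
        (fun j => Real.cos ((m1 : ℝ) * latticeMomentum L q 0) * Real.cos ((j : ℝ) * latticeMomentum L q 1)) = 0 := by
  induction row with
  | nil => intro j0 _ _; simp [rowSum]
  | cons c cs ih =>
    intro j0 hlen h0
    simp only [rowSum, Finset.sum_add_distrib, ← Finset.mul_sum]
    have hj0 : j0 < L := by simp at hlen; omega
    rw [sum_torus_cos_mul_cos_eq_zero L m1 j0 hm1 hj0 h0, mul_zero, zero_add]
    exact ih (j0 + 1) (by simp at hlen ⊢; omega) (by omega)

/-- Auxiliary lemma `sum_torus_rowSum_zero`: the frequency-`(0,0)` row averages to `L²·row[0]`. -/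
theorem sum_torus_rowSum_zero (L : ℕ) [NeZero L] (row : List ℚ) (hlen : row.length ≤ L) :
    ∑ q : TorusSite 2 L, rowSum row 0
        (fun j => Real.cos (((0 : ℕ) : ℝ) * latticeMomentum L q 0) * Real.cos ((j : ℝ) * latticeMomentum L q 1)) =
      (L : ℝ) ^ 2 * ((row.headD 0 : ℚ) : ℝ) := by
  cases row with
  | nil => simp [rowSum]
  | cons c cs =>
    simp only [rowSum, Finset.sum_add_distrib, ← Finset.mul_sum, List.headD_cons]
    have hL : 0 < L := Nat.pos_of_ne_zero (NeZero.ne L)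
    rw [sum_torus_rowSum_eq_zero L cs 0 hL 1 (by simp at hlen ⊢; omega) (by omega), add_zero]
    simp only [Nat.cast_zero, zero_mul, Real.cos_zero, one_mul, Finset.sum_const,
      Finset.card_univ, nsmul_eq_mul, card_torusSite_two_real']
    ring

/-- Auxiliary lemma `sum_torus_tableSum_eq_zero`: rows at non-zero first frequency average to zero. -/
theorem sum_torus_tableSum_eq_zero (L : ℕ) [NeZero L] (W : List (List ℚ)) :
    ∀ i0 : ℕ, W.length + i0 ≤ L → (∀ row ∈ W, row.length ≤ L) → i0 ≠ 0 →
      ∑ q : TorusSite 2 L, tableSum W i0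
        (fun i j => Real.cos ((i : ℝ) * latticeMomentum L q 0) * Real.cos ((j : ℝ) * latticeMomentum L q 1)) = 0 := by
  induction W with
  | nil => intro i0 _ _ _; simp [tableSum]
  | cons row rows ih =>
    intro i0 hlen hrows hi0
    simp only [tableSum, Finset.sum_add_distrib]
    have hi0L : i0 < L := by simp at hlen; omega
    rw [sum_torus_rowSum_eq_zero L row i0 hi0L 0 (by simpa using hrows row (by simp)) (by omega),
      zero_add]
    exact ih (i0 + 1) (by simp at hlen ⊢; omega) (fun r hr => hrows r (by simp [hr])) (by omega)

/-- **Lattice average of a table series = its `(0,0)` entry** when all frequencies are `< L`.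
[folklore] -/
theorem sum_torus_tableSum (L : ℕ) [NeZero L] (W : List (List ℚ)) (hW : W.length ≤ L)
    (hrows : ∀ row ∈ W, row.length ≤ L) :
    ∑ q : TorusSite 2 L, tableSum W 0
        (fun i j => Real.cos ((i : ℝ) * latticeMomentum L q 0) * Real.cos ((j : ℝ) * latticeMomentum L q 1)) =
      (L : ℝ) ^ 2 * ((((W.headD []).headD 0 : ℚ)) : ℝ) := by
  cases W with
  | nil => simp [tableSum]
  | cons row rows =>
    simp only [tableSum, Finset.sum_add_distrib, List.headD_cons]
    rw [sum_torus_rowSum_zero L row (hrows row (by simp)),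
      sum_torus_tableSum_eq_zero L rows 1 (by simp at hW ⊢; omega)
        (fun r hr => hrows r (by simp [hr])) one_ne_zero, add_zero]

/-! ### Σ-kernels: the polynomials `K = t₀ - E_{Q}·R²` and `T_θ = R²(θE + E_Q/θ)/2` -/

/-- `E_{q+Q} = 2 + cos q₀ + cos q₁` (outer variable `cos q₀`, inner `cos q₁`). [folklore] -/
def eQQ : List (List ℚ) := [[2, 1], [1]]

/-- `E_q = 2 - cos q₀ - cos q₁`. [folklore] -/
def eQ : List (List ℚ) := [[2, -1], [-1]]

/-- Auxiliary lemma `peval2_eQQ`. -/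
theorem peval2_eQQ (x y : ℝ) : peval2 eQQ x y = 2 + (x + y) := by
  simp [eQQ]; ring

/-- Auxiliary lemma `peval2_eQ`. -/
theorem peval2_eQ (x y : ℝ) : peval2 eQ x y = 2 - (x + y) := by
  simp [eQ]; ring

/-- The symmetrised pair `v_{ab} = T_a(x)T_b(y) + T_b(x)T_a(y)` (`a ≠ b`), `T_a(x)T_a(y)` (`a = b`).
[folklore] -/
def vab (a b : ℕ) : List (List ℚ) :=
  if a = b then outer (chebT a) (chebT a)
  else padd2 (outer (chebT a) (chebT b)) (outer (chebT b) (chebT a))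

/-- `R = Σ g_{ab} v_{ab}` from a coefficient list `[(a, b, g_{ab}), …]`. [folklore] -/
def rPoly : List (ℕ × ℕ × ℚ) → List (List ℚ)
  | [] => []
  | (a, b, g) :: gs => padd2 (pscale2 g (vab a b)) (rPoly gs)

/-- The Σ-kernel `K = t₀ - (2 + cos q₀ + cos q₁)·R²` in the power basis. [folklore] -/
def sigmaKernelPoly (t₀ : ℚ) (G : List (ℕ × ℕ × ℚ)) : List (List ℚ) :=
  padd2 [[t₀]] (pscale2 (-1) (pmul2 eQQ (pmul2 (rPoly G) (rPoly G))))

/-- The Σ-majorant `T_θ = R²·(θ(2 - cos q₀ - cos q₁) + (2 + cos q₀ + cos q₁)/θ)/2`. [folklore] -/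
def sigmaMajorPoly (θ : ℚ) (G : List (ℕ × ℕ × ℚ)) : List (List ℚ) :=
  pmul2 (pmul2 (rPoly G) (rPoly G)) (padd2 (pscale2 (θ / 2) eQ) (pscale2 (1 / (2 * θ)) eQQ))

/-- The real function `R(q₀,q₁)` of a coefficient list. [folklore] -/
noncomputable def rFun (G : List (ℕ × ℕ × ℚ)) (q₀ q₁ : ℝ) : ℝ :=
  peval2 (rPoly G) (Real.cos q₀) (Real.cos q₁)

/-- Auxiliary lemma `peval2_sigmaKernelPoly`. -/
theorem peval2_sigmaKernelPoly (t₀ : ℚ) (G : List (ℕ × ℕ × ℚ)) (q₀ q₁ : ℝ) :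
    peval2 (sigmaKernelPoly t₀ G) (Real.cos q₀) (Real.cos q₁) =
      (t₀ : ℝ) - (2 + (Real.cos q₀ + Real.cos q₁)) * rFun G q₀ q₁ ^ 2 := by
  rw [sigmaKernelPoly, peval2_padd2, peval2_pscale2, peval2_pmul2, peval2_pmul2, peval2_eQQ, rFun]
  simp only [peval2_cons, peval2_nil, peval_cons, peval_nil, mul_zero, add_zero]
  push_cast
  ring

/-- Auxiliary lemma `peval2_sigmaMajorPoly`. -/
theorem peval2_sigmaMajorPoly (θ : ℚ) (G : List (ℕ × ℕ × ℚ)) (q₀ q₁ : ℝ) :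
    peval2 (sigmaMajorPoly θ G) (Real.cos q₀) (Real.cos q₁) =
      rFun G q₀ q₁ ^ 2 * ((θ : ℝ) / 2 * (2 - (Real.cos q₀ + Real.cos q₁)) +
        1 / (2 * (θ : ℝ)) * (2 + (Real.cos q₀ + Real.cos q₁))) := by
  rw [sigmaMajorPoly, peval2_pmul2, peval2_pmul2, peval2_padd2, peval2_pscale2, peval2_pscale2, peval2_eQ,
    peval2_eQQ, rFun]
  push_cast
  ring

/-! ### The domination step (AM–GM) and the Σ-majorant theorem -/

/-- `X ((2-s)/(2+s))^{1/2} ≤ Y` from `X, Y ≥ 0`, `2 + s > 0`, `X²(2-s) ≤ Y²(2+s)`. [folklore] -/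
private theorem mul_sqrt_div_le' {X Y s : ℝ} (hX : 0 ≤ X) (hY : 0 ≤ Y) (hs : 0 < 2 + s)
    (h : X ^ 2 * (2 - s) ≤ Y ^ 2 * (2 + s)) : X * Real.sqrt ((2 - s) / (2 + s)) ≤ Y := by
  calc X * Real.sqrt ((2 - s) / (2 + s))
      = Real.sqrt (X ^ 2 * ((2 - s) / (2 + s))) := by
        rw [Real.sqrt_mul (sq_nonneg X), Real.sqrt_sq hX]
    _ ≤ Real.sqrt (Y ^ 2) := Real.sqrt_le_sqrt (by rw [← mul_div_assoc, div_le_iff₀ hs]; exact h)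
    _ = Y := Real.sqrt_sq hY

/-- **Σ-domination (AM–GM).** If `K = t₀ - (2+s)X` with `t₀ ≥ 0`, `X ≥ 0`, `-2 < s ≤ 2`, `θ > 0`, then
`max(-K, 0)·((2-s)/(2+s))^{1/2} ≤ X·(θ(2-s)/2 + (2+s)/(2θ))`. [folklore] -/
theorem sigma_dom {K X s t₀ θ : ℝ} (hX : 0 ≤ X) (ht₀ : 0 ≤ t₀) (hθ : 0 < θ) (hs : -2 < s)
    (hs2 : s ≤ 2) (hK : K = t₀ - (2 + s) * X) :
    max (-K) 0 * Real.sqrt ((2 - s) / (2 + s)) ≤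
      X * (θ / 2 * (2 - s) + 1 / (2 * θ) * (2 + s)) := by
  have h2s : 0 < 2 + s := by linarith
  have hA : 0 ≤ (2 + s) * X := mul_nonneg h2s.le hX
  have hmax : max (-K) 0 ≤ (2 + s) * X := max_le (by rw [hK]; linarith) hA
  have hsq : 0 ≤ Real.sqrt ((2 - s) / (2 + s)) := Real.sqrt_nonneg _
  set p := θ / 2 * (2 - s) with hp
  set r := 1 / (2 * θ) * (2 + s) with hr
  have hp0 : 0 ≤ p := by rw [hp]; exact mul_nonneg (by positivity) (by linarith)
  have hr0 : 0 ≤ r := by rw [hr]; positivity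
  have hpr : p * r = (2 - s) * (2 + s) / 4 := by
    rw [hp, hr]; field_simp; ring
  have key : (2 + s) * (2 - s) ≤ (p + r) ^ 2 := by nlinarith [sq_nonneg (p - r)]
  have hB : 0 ≤ X * (p + r) := mul_nonneg hX (add_nonneg hp0 hr0)
  calc max (-K) 0 * Real.sqrt ((2 - s) / (2 + s))
      ≤ (2 + s) * X * Real.sqrt ((2 - s) / (2 + s)) := mul_le_mul_of_nonneg_right hmax hsq
    _ ≤ X * (p + r) := by
        refine mul_sqrt_div_le' hA hB h2s ?_
        have hX2 : 0 ≤ X ^ 2 * (2 + s) := mul_nonneg (sq_nonneg X) h2s.le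
        calc ((2 + s) * X) ^ 2 * (2 - s) = X ^ 2 * (2 + s) * ((2 + s) * (2 - s)) := by ring
          _ ≤ X ^ 2 * (2 + s) * (p + r) ^ 2 := mul_le_mul_of_nonneg_left key hX2
          _ = (X * (p + r)) ^ 2 * (2 + s) := by ring

/-- **Validity lemma (i) for Σ-kernels — the `L`-uniform constant.**  If the kernel decides (a) `W + t ≡ t₀ - E_Q·R²` (`R = Σ g v`) and
(b) `Nu ≡ T_θ = R²(θE + E_Q/θ)/2` as polynomials in `(cos q₀, cos q₁)`, with `t₀ ≥ 0`, `θ > 0`, table dimensions `≤ N ≤ 2k`, then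
`𝓦_K(2k) ≤ Nu[0][0]`.  HONEST FRAMING: ladder R1–R4 with certified numbers; no claim on H/H₀. [cite: KLS1988JSP, eqs. (4), (6)-(9)] -/
theorem sigma_riemannSum_le (k N : ℕ) (hk : 1 ≤ k) (hN : N ≤ 2 * k) (W Nu : List (List ℚ))
    (t t₀ θ : ℚ) (G : List (ℕ × ℕ × ℚ)) (ht₀ : 0 ≤ t₀) (hθ : 0 < θ)
    (hW : W.length ≤ N) (hWr : ∀ row ∈ W, row.length ≤ N)
    (hNu : Nu.length ≤ N) (hNur : ∀ row ∈ Nu, row.length ≤ N)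
    (hK : equiv2 (padd2 (ofCosTable W 0) [[t]]) (sigmaKernelPoly t₀ G) = true)
    (hT : equiv2 (ofCosTable Nu 0) (sigmaMajorPoly θ G) = true) :
    haveI : NeZero (2 * k) := ⟨by omega⟩
    klsKernelRiemannSum (2 * k) (windowDict (2 * k) (range N ×ˢ range N) (tableFun W)) 0 (t : ℝ) ≤
      ((((Nu.headD []).headD 0 : ℚ)) : ℝ) := by
  haveI : NeZero (2 * k) := ⟨by omega⟩
  have hθ' : (0 : ℝ) < θ := by exact_mod_cast hθ
  have ht₀' : (0 : ℝ) ≤ t₀ := by exact_mod_cast ht₀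
  have hL : (0 : ℝ) < (((2 * k : ℕ) : ℝ)) ^ 2 := by positivity
  -- the kernel identity `K(q) = t₀ - (2 + s) R²` at every dual-torus point
  have hKq : ∀ q : TorusSite 2 (2 * k), klsKernel (2 * k) (windowDict (2 * k) (range N ×ˢ range N) (tableFun W)) 0 (t : ℝ) q =
      (t₀ : ℝ) - (2 + (Real.cos (latticeMomentum (2 * k) q 0) + Real.cos (latticeMomentum (2 * k) q 1))) *
        rFun G (latticeMomentum (2 * k) q 0) (latticeMomentum (2 * k) q 1) ^ 2 := by
    intro q
    rw [klsKernel_table (2 * k) W N N hW hWr, ← peval2_ofCosTable, ← peval2_sigmaKernelPoly,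
      ← peval2_eq_of_equiv2 hK, peval2_padd2]
    simp
  -- the majorant identity `T_θ = table series of Nu`
  have hTq : ∀ q : TorusSite 2 (2 * k),
      rFun G (latticeMomentum (2 * k) q 0) (latticeMomentum (2 * k) q 1) ^ 2 *
        ((θ : ℝ) / 2 * (2 - (Real.cos (latticeMomentum (2 * k) q 0) + Real.cos (latticeMomentum (2 * k) q 1))) +
          1 / (2 * (θ : ℝ)) * (2 + (Real.cos (latticeMomentum (2 * k) q 0) + Real.cos (latticeMomentum (2 * k) q 1)))) =
        tableSum Nu 0 (fun i j => Real.cos ((i : ℝ) * latticeMomentum (2 * k) q 0) * Real.cos ((j : ℝ) * latticeMomentum (2 * k) q 1)) := by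
    intro q
    rw [← peval2_sigmaMajorPoly, ← peval2_eq_of_equiv2 hT, peval2_ofCosTable]
  have hC : ∀ q : TorusSite 2 (2 * k), torusCosSum (2 * k) q =
      Real.cos (latticeMomentum (2 * k) q 0) + Real.cos (latticeMomentum (2 * k) q 1) := fun q => by
    simp [torusCosSum, Fin.sum_univ_two]
  -- termwise domination off the Néel point
  have hterm : ∀ q ∈ (univ : Finset (TorusSite 2 (2 * k))).erase (neelIndex (2 * k)),
      max (-klsKernel (2 * k) (windowDict (2 * k) (range N ×ˢ range N) (tableFun W)) 0 (t : ℝ) q) 0 *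
          Real.sqrt (dispersion (latticeMomentum (2 * k) q) /
            dispersion (latticeMomentum (2 * k) (q - neelIndex (2 * k)))) ≤
        tableSum Nu 0 (fun i j => Real.cos ((i : ℝ) * latticeMomentum (2 * k) q 0) * Real.cos ((j : ℝ) * latticeMomentum (2 * k) q 1)) := by
    intro q hq
    have hq' : q ≠ neelIndex (2 * k) := ne_of_mem_erase hq
    have hE1 : dispersion (latticeMomentum (2 * k) q) =
        2 - (Real.cos (latticeMomentum (2 * k) q 0) + Real.cos (latticeMomentum (2 * k) q 1)) := by
      rw [dispersion_latticeMomentum_eq, hC]; norm_num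
    have hE2 : dispersion (latticeMomentum (2 * k) (q - neelIndex (2 * k))) =
        2 + (Real.cos (latticeMomentum (2 * k) q 0) + Real.cos (latticeMomentum (2 * k) q 1)) := by
      rw [dispersion_latticeMomentum_sub_neelIndex k q, hC]; norm_num
    have hpos : 0 < 2 + (Real.cos (latticeMomentum (2 * k) q 0) + Real.cos (latticeMomentum (2 * k) q 1)) := by
      rw [← hE2]; exact dispersion_latticeMomentum_pos (sub_ne_zero.2 hq')
    have hs2 : Real.cos (latticeMomentum (2 * k) q 0) + Real.cos (latticeMomentum (2 * k) q 1) ≤ 2 := by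
      linarith [Real.cos_le_one (latticeMomentum (2 * k) q 0), Real.cos_le_one (latticeMomentum (2 * k) q 1)]
    rw [hE1, hE2, ← hTq q]
    exact sigma_dom (sq_nonneg _) ht₀' hθ' (by linarith) hs2 (hKq q)
  -- `T_θ ≥ 0` everywhere
  have hM0 : ∀ q : TorusSite 2 (2 * k), 0 ≤
      tableSum Nu 0 (fun i j => Real.cos ((i : ℝ) * latticeMomentum (2 * k) q 0) * Real.cos ((j : ℝ) * latticeMomentum (2 * k) q 1)) := by
    intro q
    rw [← hTq q]
    have h1 : -2 ≤ Real.cos (latticeMomentum (2 * k) q 0) + Real.cos (latticeMomentum (2 * k) q 1) := by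
      linarith [Real.neg_one_le_cos (latticeMomentum (2 * k) q 0), Real.neg_one_le_cos (latticeMomentum (2 * k) q 1)]
    have h2 : Real.cos (latticeMomentum (2 * k) q 0) + Real.cos (latticeMomentum (2 * k) q 1) ≤ 2 := by
      linarith [Real.cos_le_one (latticeMomentum (2 * k) q 0), Real.cos_le_one (latticeMomentum (2 * k) q 1)]
    refine mul_nonneg (sq_nonneg _) (add_nonneg ?_ ?_)
    · exact mul_nonneg (by positivity) (by linarith)
    · exact mul_nonneg (by positivity) (by linarith)
  unfold klsKernelRiemannSum
  rw [div_le_iff₀ hL]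
  calc ∑ q ∈ (univ : Finset (TorusSite 2 (2 * k))).erase (neelIndex (2 * k)),
        max (-klsKernel (2 * k) (windowDict (2 * k) (range N ×ˢ range N) (tableFun W)) 0 (t : ℝ) q) 0 *
          Real.sqrt (dispersion (latticeMomentum (2 * k) q) /
            dispersion (latticeMomentum (2 * k) (q - neelIndex (2 * k))))
      ≤ ∑ q ∈ (univ : Finset (TorusSite 2 (2 * k))).erase (neelIndex (2 * k)),
          tableSum Nu 0 (fun i j => Real.cos ((i : ℝ) * latticeMomentum (2 * k) q 0) *
            Real.cos ((j : ℝ) * latticeMomentum (2 * k) q 1)) := sum_le_sum hterm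
    _ ≤ ∑ q : TorusSite 2 (2 * k), tableSum Nu 0 (fun i j => Real.cos ((i : ℝ) * latticeMomentum (2 * k) q 0) *
            Real.cos ((j : ℝ) * latticeMomentum (2 * k) q 1)) :=
        sum_le_sum_of_subset_of_nonneg (erase_subset _ _) fun q _ _ => hM0 q
    _ = ((((Nu.headD []).headD 0 : ℚ)) : ℝ) * (((2 * k : ℕ) : ℝ)) ^ 2 := by
        rw [sum_torus_tableSum (2 * k) Nu (hNu.trans hN) (fun r hr => (hNur r hr).trans hN), mul_comm]

/-- **The sign condition `K(Q) ≥ 0` of a Σ-kernel** (`K(Q) = t₀ ≥ 0`; `cos(mπ)cos(m'π) = (-1)^{m+m'}`). [folklore] -/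
theorem sigma_KQ_nonneg (N : ℕ) (W : List (List ℚ)) (t t₀ : ℚ) (G : List (ℕ × ℕ × ℚ))
    (ht₀ : 0 ≤ t₀) (hW : W.length ≤ N) (hWr : ∀ row ∈ W, row.length ≤ N)
    (hK : equiv2 (padd2 (ofCosTable W 0) [[t]]) (sigmaKernelPoly t₀ G) = true) :
    0 ≤ ∑ p ∈ range N ×ˢ range N, tableFun W p * (-1 : ℝ) ^ (p.1 + p.2) - 0 + (t : ℝ) := by
  have e : ∀ p : ℕ × ℕ, (-1 : ℝ) ^ (p.1 + p.2) =
      Real.cos ((p.1 : ℝ) * Real.pi) * Real.cos ((p.2 : ℝ) * Real.pi) := by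
    intro p; rw [Real.cos_nat_mul_pi, Real.cos_nat_mul_pi, ← pow_add]
  simp_rw [e]
  rw [sum_tableFun_mul W N N hW hWr (fun i j => Real.cos ((i : ℝ) * Real.pi) * Real.cos ((j : ℝ) * Real.pi)),
    ← peval2_ofCosTable]
  have h := peval2_eq_of_equiv2 hK (Real.cos Real.pi) (Real.cos Real.pi)
  rw [peval2_padd2, peval2_sigmaKernelPoly] at h
  simp only [peval2_cons, peval2_nil, peval_cons, peval_nil, mul_zero, add_zero, Real.cos_pi] at h ⊢
  have ht₀' : (0 : ℝ) ≤ t₀ := by exact_mod_cast ht₀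
  norm_num at h ⊢
  linarith [h, ht₀']

/-- **Validity lemma (i), LP form: the Σ-kernel row** — for every even side `2k ≥ N` (`k ≥ 2`) and tangent point `x₀ > 0`:
`-t/4 - W̄(x₀/2 + (-c(0,1))/(4x₀)) ≤ Σ_{(a,b)} W[a][b]·c_{2k}(a,b)`, `W̄ = Nu[0][0]` (the tree's `kls_heis_windowDict_cut_spinHalf` with its constant
supplied exactly). HONEST FRAMING: ladder R1–R4 with certified numbers; no claim on H/H₀. [cite: KLS1988JSP, eqs. (4), (6)-(9)] [cite: DLS1978, Theorem 4.2] -/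
theorem sigma_cut_spinHalf (k N : ℕ) (hk : 2 ≤ k) (hN : N ≤ 2 * k) (W Nu : List (List ℚ))
    (t t₀ θ : ℚ) (G : List (ℕ × ℕ × ℚ)) (ht₀ : 0 ≤ t₀) (hθ : 0 < θ)
    (hW : W.length ≤ N) (hWr : ∀ row ∈ W, row.length ≤ N)
    (hNu : Nu.length ≤ N) (hNur : ∀ row ∈ Nu, row.length ≤ N)
    (hK : equiv2 (padd2 (ofCosTable W 0) [[t]]) (sigmaKernelPoly t₀ G) = true)
    (hT : equiv2 (ofCosTable Nu 0) (sigmaMajorPoly θ G) = true)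
    {x₀ : ℝ} (hx : 0 < x₀) :
    haveI : NeZero (2 * k) := ⟨by omega⟩
    (-(t : ℝ) / 4 - ((((Nu.headD []).headD 0 : ℚ)) : ℝ) *
        (x₀ / 2 + (-heisRedCorr2 (2 * k) 1 0 1) / (4 * x₀))) ≤
      ∑ p ∈ range N ×ˢ range N, tableFun W p * heisRedCorr2 (2 * k) 1 p.1 p.2 := by
  haveI : NeZero (2 * k) := ⟨by omega⟩
  have hKQ := sigma_KQ_nonneg N W t t₀ G ht₀ hW hWr hK
  have hWbar := sigma_riemannSum_le k N (by omega) hN W Nu t t₀ θ G ht₀ hθ hW hWr hNu hNur hK hT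
  have h := kls_heis_windowDict_cut_spinHalf k hk (range N ×ˢ range N) (tableFun W)
    (b := 0) (t := (t : ℝ)) hx hKQ hWbar
  linarith

/-- **The Σ-kernel row in linear form** (the shape accumulated by `irk_acc_step`):
`(-t/4 - W̄ x₀/2) + (W̄/(4x₀))·c(0,1) ≤ Σ_p W[p]·c_{2k}(p)`. HONEST FRAMING: ladder R1–R4 with certified numbers;
no claim on H/H₀. [cite: KLS1988JSP, eqs. (4), (6)-(9)] [cite: DLS1978, Theorem 4.2] -/
theorem sigma_cut_spinHalf' (k N : ℕ) (hk : 2 ≤ k) (hN : N ≤ 2 * k) (W Nu : List (List ℚ))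
    (t t₀ θ : ℚ) (G : List (ℕ × ℕ × ℚ)) (ht₀ : 0 ≤ t₀) (hθ : 0 < θ)
    (hW : W.length ≤ N) (hWr : ∀ row ∈ W, row.length ≤ N)
    (hNu : Nu.length ≤ N) (hNur : ∀ row ∈ Nu, row.length ≤ N)
    (hK : equiv2 (padd2 (ofCosTable W 0) [[t]]) (sigmaKernelPoly t₀ G) = true)
    (hT : equiv2 (ofCosTable Nu 0) (sigmaMajorPoly θ G) = true)
    {x₀ : ℝ} (hx : 0 < x₀) :
    haveI : NeZero (2 * k) := ⟨by omega⟩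
    (-(t : ℝ) / 4 - ((((Nu.headD []).headD 0 : ℚ)) : ℝ) * x₀ / 2) +
        ((((Nu.headD []).headD 0 : ℚ)) : ℝ) / (4 * x₀) * heisRedCorr2 (2 * k) 1 0 1 ≤
      ∑ p ∈ range N ×ˢ range N, tableFun W p * heisRedCorr2 (2 * k) 1 p.1 p.2 := by
  haveI : NeZero (2 * k) := ⟨by omega⟩
  have h := sigma_cut_spinHalf k N hk hN W Nu t t₀ θ G ht₀ hθ hW hWr hNu hNur hK hT hx
  have e : (-(t : ℝ) / 4 - ((((Nu.headD []).headD 0 : ℚ)) : ℝ) *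
      (x₀ / 2 + (-heisRedCorr2 (2 * k) 1 0 1) / (4 * x₀))) =
      (-(t : ℝ) / 4 - ((((Nu.headD []).headD 0 : ℚ)) : ℝ) * x₀ / 2) +
        ((((Nu.headD []).headD 0 : ℚ)) : ℝ) / (4 * x₀) * heisRedCorr2 (2 * k) 1 0 1 := by
    field_simp
    ring
  linarith

/-! ### Accumulating the IRK rows of a certificate table-wise -/

/-- Start of the accumulation: the empty table. [folklore] -/
theorem irk_acc_start (S : Finset (ℕ × ℕ)) (F : ℕ → ℕ → ℝ) (c : ℝ) :
    (0 : ℝ) + (0 : ℝ) * c ≤ ∑ p ∈ S, tableFun [] p * F p.1 p.2 := by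
  simp [tableFun]

/-- **One accumulation step**: add `y ≥ 0` times a row `a + b·c ≤ Σ_p W[p] F(p)` to the running row
`A + B·c ≤ Σ_p Wacc[p] F(p)`; the new table is `Wacc + y·W`. [folklore] -/
theorem irk_acc_step {S : Finset (ℕ × ℕ)} {F : ℕ → ℕ → ℝ} {A B a b c : ℝ} {Wacc W : List (List ℚ)}
    (y : ℚ) (hy : 0 ≤ y) (hacc : A + B * c ≤ ∑ p ∈ S, tableFun Wacc p * F p.1 p.2)
    (h : a + b * c ≤ ∑ p ∈ S, tableFun W p * F p.1 p.2) :
    (A + (y : ℝ) * a) + (B + (y : ℝ) * b) * c ≤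
      ∑ p ∈ S, tableFun (padd2 Wacc (pscale2 y W)) p * F p.1 p.2 := by
  have hy' : (0 : ℝ) ≤ y := by exact_mod_cast hy
  have h2 := mul_le_mul_of_nonneg_left h hy'
  simp_rw [tableFun_padd2, tableFun_pscale2, add_mul, Finset.sum_add_distrib]
  rw [Finset.mul_sum] at h2
  have e : ∑ p ∈ S, (y : ℝ) * tableFun W p * F p.1 p.2 = ∑ p ∈ S, (y : ℝ) * (tableFun W p * F p.1 p.2) :=
    Finset.sum_congr rfl fun p _ => by ring
  rw [e]
  linarith

/-- **Reading the accumulated table off a literal**: if the kernel decides `equiv2 Wacc Wc`, the accumulated row holds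
with the literal table `Wc`. [folklore] -/
theorem irk_acc_read {S : Finset (ℕ × ℕ)} {F : ℕ → ℕ → ℝ} {A B c : ℝ} {Wacc Wc : List (List ℚ)}
    (hacc : A + B * c ≤ ∑ p ∈ S, tableFun Wacc p * F p.1 p.2) (h : equiv2 Wacc Wc = true) :
    A + B * c ≤ ∑ p ∈ S, tableFun Wc p * F p.1 p.2 := by
  rw [Finset.sum_congr rfl fun p _ => by rw [tableFun_eq_of_equiv2 h p]] at hacc
  exact hacc

end Summit.HubbardSuperconductivity.HubbardLadder.PolyCert
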